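import Literature.Topology.FourManifolds.MorseChartChange
import Mathlib.Geometry.Manifold.IsManifold.InteriorBoundary
import HarnessLib

/-!
# Chart-independence of critical points, Hessian and Morse index at interior points

Topic `Literature/Topology/FourManifolds` (fact seat
`provefact-Literature.SPC4.exists_isMorse_isSelfIndexing`).  `MorseChartChange.lean` proves that the
Hessian of a `C²` function at a critical point read in any chart of the maximal atlas is
congruent to the chartwise Hessian `Literature.Topology.FourManifolds.mhessian` (so nondegeneracy and the Morse index do
not depend on the chart; Milnor 1963, §2) for manifolds over a *boundaryless model*
(`I.Boundaryless`).  This file proves the same statements at **interior points** of a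
manifold over an arbitrary model with corners (so that they apply to the total space of a
cobordism, model `𝓡∂ (n + 1)`, all of whose critical points are interior):

* `Literature.Topology.FourManifolds.mem_interior_range_extend_of_mem_maximalAtlas` — a chart of the `C¹` maximal atlas maps
  interior points into the interior of the model (Mathlib's
  `mem_interior_range_of_mem_interior_range_of_mem_atlas`, same proof, for the maximal atlas);
* `Literature.Topology.FourManifolds.mhessian_apply_eq_hessianInChart_of_isInteriorPoint`,
  `Literature.Topology.FourManifolds.nondegenerate_mhessian_iff_of_isInteriorPoint`,
  `Literature.Topology.FourManifolds.morseIndex_eq_sigNeg_hessianInChart_of_isInteriorPoint`,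
  `Literature.Topology.FourManifolds.isMCriticalPt_iff_fderiv_comp_extend_symm_eq_zero_of_isInteriorPoint` — the
  chart-change theorems at an interior point; and
  `Literature.Topology.FourManifolds.hessianInChart_apply_eq_fderiv_fderiv_of_isInteriorPoint` — at an interior point the
  chart Hessian is a plain second Fréchet derivative.

## References

* J. Milnor, *Morse theory*, Ann. of Math. Studies 51 (1963), §2. [Milnor1963]
-/

open scoped Manifold ContDiff Topology
open Set Function Filter

noncomputable section

namespace Literature.Topology.FourManifolds

variable {E H : Type*} [NormedAddCommGroup E] [NormedSpace ℝ E] [TopologicalSpace H]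
  {I : ModelWithCorners ℝ E H} {M : Type*} [TopologicalSpace M] [ChartedSpace H M]

/-! ### Charts of the maximal atlas preserve interior points -/

/-- **A chart of the `Cⁿ` maximal atlas (`n ≥ 1`) maps an interior point into the interior of
the range of the model** (chart-independence of the interior; Mathlib proves this for charts
of the atlas, `mem_interior_range_of_mem_interior_range_of_mem_atlas`, and the proof — the
differential of the change of coordinates is surjective, and a differentiable map with
surjective differential cannot send an interior point of its domain to the boundary of a closed
convex set — applies verbatim to the maximal atlas).  The case `n = ∞` is the tree's
`Literature.Topology.FourManifolds.mem_interior_range_of_mem_maximalAtlas` (`SPC4HandleChainProofs.lean`, via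
`MDifferentiableAt.isInteriorPoint_of_surjective_mfderiv`); the `Cⁿ` version (`n ≠ 0`) is needed
here for the `C²` chart-change theorems below. [folklore] -/
theorem mem_interior_range_extend_of_mem_maximalAtlas {n : WithTop ℕ∞} [IsManifold I n M] (hn : n ≠ 0)
    {e : OpenPartialHomeomorph M H} (he : e ∈ IsManifold.maximalAtlas I n M) {x : M}
    (hxe : x ∈ e.source) (hx : I.IsInteriorPoint x) : e.extend I x ∈ interior (range I) := by
  set e₀ := chartAt H x with he₀def
  have he₀ : e₀ ∈ IsManifold.maximalAtlas I n M := IsManifold.chart_mem_maximalAtlas x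
  have hxe₀ : x ∈ e₀.source := mem_chart_source H x
  have hx' : e₀.extend I x ∈ interior (e₀.extend I).target := I.isInteriorPoint_iff.1 hx
  let φ := I.extendCoordChange e₀ e
  have hφ : ContDiffOn ℝ n φ φ.source := I.contDiffOn_extendCoordChange he₀ he
  suffices h : Function.Surjective (fderivWithin ℝ φ φ.source (e₀.extend I x)) →
      e.extend I x ∈ interior (range I) by
    refine h ?_
    exact (I.isInvertible_fderivWithin_extendCoordChange hn he₀ he <| by simp [hxe, hxe₀]).surjective
  intro hφx'
  have hφx : φ.source ∈ 𝓝 (e₀.extend I x) := by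
    simp_rw [φ, ModelWithCorners.extendCoordChange, PartialEquiv.trans_source, PartialEquiv.symm_source,
      Filter.inter_mem_iff, mem_interior_iff_mem_nhds.1 hx', true_and, e.extend_source]
    exact e₀.extend_preimage_mem_nhds hxe₀ <| e.open_source.mem_nhds hxe
  rw [fderivWithin_of_mem_nhds hφx] at hφx'
  rw [show e.extend I x = φ (e₀.extend I x) by simp [φ, hxe₀]]
  have hφd : DifferentiableAt ℝ φ (e₀.extend I x) := (hφ.differentiableOn hn).differentiableAt hφx
  exact hφd.mem_interior_convex_of_surjective_fderiv hφx I.convex_range I.isClosed_range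
    I.nonempty_interior (φ.mapsTo.mono_right <| by simp [φ, inter_assoc]) hφx'

/-- At an interior point, the range of the model is a neighbourhood of the image under any chart
of the maximal atlas. [folklore] -/
theorem range_mem_nhds_extend_of_isInteriorPoint {n : WithTop ℕ∞} [IsManifold I n M] (hn : n ≠ 0)
    {e : OpenPartialHomeomorph M H} (he : e ∈ IsManifold.maximalAtlas I n M) {x : M}
    (hxe : x ∈ e.source) (hx : I.IsInteriorPoint x) : range I ∈ 𝓝 (e.extend I x) :=
  mem_interior_iff_mem_nhds.1 (mem_interior_range_extend_of_mem_maximalAtlas hn he hxe hx)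

/-! ### The chart-change theorems at an interior point -/

section ChangeOfChart

variable {f : M → ℝ} {x : M} {e : OpenPartialHomeomorph M H}

/-- `f` read in a chart `e` of the `C²` maximal atlas is `C²` at the image of an interior point
`x ∈ e.source` at which `f` is `C²`. [folklore] -/
theorem contDiffAt_comp_extend_symm_of_isInteriorPoint [IsManifold I 2 M]
    (hf : ContMDiffAt I 𝓘(ℝ, ℝ) 2 f x) (he : e ∈ IsManifold.maximalAtlas I 2 M) (hxe : x ∈ e.source)
    (hx : I.IsInteriorPoint x) :
    ContDiffAt ℝ 2 (f ∘ (e.extend I).symm) (e.extend I x) := by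
  have h := (contMDiffWithinAt_iff_source_of_mem_maximalAtlas (I' := 𝓘(ℝ, ℝ)) (s := univ)
    he hxe).1 hf.contMDiffWithinAt
  rw [preimage_univ, univ_inter, contMDiffWithinAt_iff_contDiffWithinAt] at h
  exact h.contDiffAt (range_mem_nhds_extend_of_isInteriorPoint (by norm_num) he hxe hx)

/-- The source of the change of coordinates from the preferred chart at an interior point `x`
to a chart `e ∋ x` is a neighbourhood of `extChartAt I x x`. [folklore] -/
theorem extendCoordChange_source_mem_nhds_of_isInteriorPoint (hxe : x ∈ e.source)
    (hx : I.IsInteriorPoint x) :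
    (I.extendCoordChange (chartAt H x) e).source ∈ 𝓝 (extChartAt I x x) := by
  have h := I.extendCoordChange_source_mem_nhdsWithin' (e := chartAt H x) (e' := e)
    (mem_chart_source H x) hxe
  have h' : (I.extendCoordChange (chartAt H x) e).source ∈ 𝓝[range I] (extChartAt I x x) := h
  rwa [nhdsWithin_eq_nhds.2 (range_mem_nhds_isInteriorPoint hx)] at h'

/-- That change of coordinates is `C²` at `extChartAt I x x` (interior point). [folklore] -/
theorem contDiffAt_extendCoordChange_chartAt_of_isInteriorPoint [IsManifold I 2 M]
    (he : e ∈ IsManifold.maximalAtlas I 2 M) (hxe : x ∈ e.source) (hx : I.IsInteriorPoint x) :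
    ContDiffAt ℝ 2 (I.extendCoordChange (chartAt H x) e) (extChartAt I x x) := by
  have h := I.contDiffWithinAt_extendCoordChange' (n := 2)
    (IsManifold.chart_mem_maximalAtlas x) he (mem_chart_source H x) hxe
  exact h.contDiffAt (range_mem_nhds_isInteriorPoint hx)

/-- Its derivative at `extChartAt I x x` is invertible (interior point). [folklore] -/
theorem isInvertible_fderiv_extendCoordChange_chartAt_of_isInteriorPoint [IsManifold I 2 M]
    (he : e ∈ IsManifold.maximalAtlas I 2 M) (hxe : x ∈ e.source) (hx : I.IsInteriorPoint x) :
    (fderiv ℝ (I.extendCoordChange (chartAt H x) e) (extChartAt I x x)).IsInvertible := by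
  have hmem : extChartAt I x x ∈ (I.extendCoordChange (chartAt H x) e).source :=
    mem_of_mem_nhds (extendCoordChange_source_mem_nhds_of_isInteriorPoint hxe hx)
  have h := I.isInvertible_fderivWithin_extendCoordChange (n := 2) (by norm_num)
    (IsManifold.chart_mem_maximalAtlas x) he hmem
  rwa [fderivWithin_of_mem_nhds (extendCoordChange_source_mem_nhds_of_isInteriorPoint hxe hx)] at h

/-- Near `extChartAt I x x` (interior point), `f` written in the preferred chart factors
through the chart `e`. [folklore] -/
theorem writtenInExtChartAt_eventuallyEq_comp_extendCoordChange_of_isInteriorPoint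
    (hxe : x ∈ e.source) (hx : I.IsInteriorPoint x) :
    writtenInExtChartAt I 𝓘(ℝ, ℝ) x f =ᶠ[𝓝 (extChartAt I x x)]
      (f ∘ (e.extend I).symm) ∘ I.extendCoordChange (chartAt H x) e := by
  filter_upwards [extendCoordChange_source_mem_nhds_of_isInteriorPoint hxe hx] with z hz
  have hz2 : ((chartAt H x).extend I).symm z ∈ e.source := by
    have := hz.2
    simp only [mem_preimage, OpenPartialHomeomorph.extend_source] at this
    exact this
  simp only [writtenInExtChartAt_eq_comp_extend_symm, Function.comp_apply,
    PartialEquiv.coe_trans]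
  rw [e.extend_left_inv hz2]

/-- At an interior point, the chartwise derivative (within the range of the model) of `f`
written in the preferred chart is the plain Fréchet derivative. [folklore] -/
theorem fderivWithin_writtenInExtChartAt_of_isInteriorPoint (hx : I.IsInteriorPoint x) :
    fderivWithin ℝ (writtenInExtChartAt I 𝓘(ℝ, ℝ) x f) (range I) (extChartAt I x x) =
      fderiv ℝ (writtenInExtChartAt I 𝓘(ℝ, ℝ) x f) (extChartAt I x x) :=
  fderivWithin_of_mem_nhds (range_mem_nhds_isInteriorPoint hx)

/-- **Critical points are read in any chart** (interior point): `x` is a critical point of the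
`C²` function `f` iff `D(f ∘ (e.extend I)⁻¹)(e.extend I x) = 0` for a chart `e` of the `C²`
maximal atlas at `x`. [cite: Milnor1963, §2] -/
theorem isMCriticalPt_iff_fderiv_comp_extend_symm_eq_zero_of_isInteriorPoint [IsManifold I 2 M]
    (hf : ContMDiffAt I 𝓘(ℝ, ℝ) 2 f x) (he : e ∈ IsManifold.maximalAtlas I 2 M)
    (hxe : x ∈ e.source) (hx : I.IsInteriorPoint x) :
    IsMCriticalPt I f x ↔ fderiv ℝ (f ∘ (e.extend I).symm) (e.extend I x) = 0 := by
  set τ : E → E := ⇑(I.extendCoordChange (chartAt H x) e) with hτ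
  have hτ0 : τ (extChartAt I x x) = e.extend I x := by
    simp only [hτ, PartialEquiv.coe_trans, Function.comp_apply]
    exact congrArg (e.extend I) (extChartAt_to_inv x)
  have hd : MDifferentiableAt I 𝓘(ℝ, ℝ) f x := hf.mdifferentiableAt (by norm_num)
  have hFe : DifferentiableAt ℝ (f ∘ (e.extend I).symm) (τ (extChartAt I x x)) := by
    rw [hτ0]
    exact (contDiffAt_comp_extend_symm_of_isInteriorPoint hf he hxe hx).differentiableAt (by norm_num)
  have hτd : DifferentiableAt ℝ τ (extChartAt I x x) :=
    (contDiffAt_extendCoordChange_chartAt_of_isInteriorPoint he hxe hx).differentiableAt (by norm_num)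
  have hchain : fderiv ℝ (writtenInExtChartAt I 𝓘(ℝ, ℝ) x f) (extChartAt I x x) =
      (fderiv ℝ (f ∘ (e.extend I).symm) (e.extend I x)).comp (fderiv ℝ τ (extChartAt I x x)) := by
    rw [(writtenInExtChartAt_eventuallyEq_comp_extendCoordChange_of_isInteriorPoint hxe hx).fderiv_eq,
      fderiv_comp _ hFe hτd, hτ0]
  obtain ⟨L, hL⟩ := isInvertible_fderiv_extendCoordChange_chartAt_of_isInteriorPoint he hxe hx
  rw [isMCriticalPt_iff_fderivWithin_writtenInExtChartAt_eq_zero (mem_extChartAt_source x) hd,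
    fderivWithin_writtenInExtChartAt_of_isInteriorPoint hx, hchain, ← hL]
  constructor
  · intro h
    have h2 : (fderiv ℝ (f ∘ (e.extend I).symm) (e.extend I x)).comp
        ((L : E →L[ℝ] E).comp (L.symm : E →L[ℝ] E)) = (0 : E →L[ℝ] ℝ).comp (L.symm : E →L[ℝ] E) := by
      rw [← ContinuousLinearMap.comp_assoc, h]
    simpa using h2
  · intro h
    rw [h, ContinuousLinearMap.zero_comp]

/-- At an interior point, the chartwise Hessian `Literature.Topology.FourManifolds.mhessian` is the plain second Fréchet
derivative of `f` written in the preferred chart (twins: `SPC4MorseExistence.lean`,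
`TrisectionsRefutation.lean`, `ClosedAsCobordism.lean` for the synonym). [folklore] -/
theorem mhessian_apply_eq_fderiv_fderiv_of_isInteriorPoint' (hx : I.IsInteriorPoint x) (v w : E) :
    mhessian I f x v w =
      fderiv ℝ (fderiv ℝ (writtenInExtChartAt I 𝓘(ℝ, ℝ) x f)) (extChartAt I x x) v w := by
  have h1 : fderivWithin ℝ (writtenInExtChartAt I 𝓘(ℝ, ℝ) x f) (range I) =ᶠ[𝓝 (extChartAt I x x)]
      fderiv ℝ (writtenInExtChartAt I 𝓘(ℝ, ℝ) x f) := by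
    have hopen : interior (range I) ∈ 𝓝 (extChartAt I x x) := isOpen_interior.mem_nhds hx
    filter_upwards [hopen] with z hz
    exact fderivWithin_of_mem_nhds (mem_interior_iff_mem_nhds.1 hz)
  show (fderivWithin ℝ (fderivWithin ℝ (writtenInExtChartAt I 𝓘(ℝ, ℝ) x f) (range I)) (range I)
      (extChartAt I x x) v) w = _
  rw [h1.fderivWithin_eq_of_nhds, fderivWithin_of_mem_nhds (range_mem_nhds_isInteriorPoint hx)]

/-- At an interior point of a chart `e` of the `C¹` maximal atlas, the chart Hessian
`Literature.Topology.FourManifolds.hessianInChart` is the plain second Fréchet derivative of `f ∘ (e.extend I)⁻¹`. [folklore] -/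
theorem hessianInChart_apply_eq_fderiv_fderiv_of_isInteriorPoint [IsManifold I 1 M]
    (he : e ∈ IsManifold.maximalAtlas I 1 M) (hxe : x ∈ e.source) (hx : I.IsInteriorPoint x)
    (v w : E) :
    hessianInChart I e f x v w = fderiv ℝ (fderiv ℝ (f ∘ (e.extend I).symm)) (e.extend I x) v w := by
  have hint : e.extend I x ∈ interior (range I) := mem_interior_range_extend_of_mem_maximalAtlas one_ne_zero he hxe hx
  have h1 : fderivWithin ℝ (f ∘ (e.extend I).symm) (range I) =ᶠ[𝓝 (e.extend I x)]
      fderiv ℝ (f ∘ (e.extend I).symm) := by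
    filter_upwards [isOpen_interior.mem_nhds hint] with z hz
    exact fderivWithin_of_mem_nhds (mem_interior_iff_mem_nhds.1 hz)
  rw [hessianInChart_apply_apply, h1.fderivWithin_eq_of_nhds,
    fderivWithin_of_mem_nhds (mem_interior_iff_mem_nhds.1 hint)]

/-- **The Hessian at a critical interior point is chart-independent up to congruence**
(Milnor 1963, §2): `mhessian I f x (v, w) = hessianInChart I e f x (L v, L w)` with `L` the
(invertible) derivative of the change of coordinates. [cite: Milnor1963, §2] -/
theorem mhessian_apply_eq_hessianInChart_of_isInteriorPoint [IsManifold I 2 M]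
    (hf : ContMDiffAt I 𝓘(ℝ, ℝ) 2 f x) (hcrit : IsMCriticalPt I f x)
    (he : e ∈ IsManifold.maximalAtlas I 2 M) (hxe : x ∈ e.source) (hx : I.IsInteriorPoint x) (v w : E) :
    mhessian I f x v w = hessianInChart I e f x
      (fderiv ℝ (I.extendCoordChange (chartAt H x) e) (extChartAt I x x) v)
      (fderiv ℝ (I.extendCoordChange (chartAt H x) e) (extChartAt I x x) w) := by
  set τ : E → E := ⇑(I.extendCoordChange (chartAt H x) e) with hτ
  have hτ0 : τ (extChartAt I x x) = e.extend I x := by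
    simp only [hτ, PartialEquiv.coe_trans, Function.comp_apply]
    exact congrArg (e.extend I) (extChartAt_to_inv x)
  have hcrit' : fderiv ℝ (f ∘ (e.extend I).symm) (τ (extChartAt I x x)) = 0 := by
    rw [hτ0]
    exact (isMCriticalPt_iff_fderiv_comp_extend_symm_eq_zero_of_isInteriorPoint hf he hxe hx).1 hcrit
  have hF : ContDiffAt ℝ 2 (f ∘ (e.extend I).symm) (τ (extChartAt I x x)) := by
    rw [hτ0]; exact contDiffAt_comp_extend_symm_of_isInteriorPoint hf he hxe hx
  have key := fderiv_fderiv_comp_apply_of_fderiv_eq_zero hF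
    (contDiffAt_extendCoordChange_chartAt_of_isInteriorPoint he hxe hx) hcrit' v w
  rw [hτ0] at key
  have he1 : e ∈ IsManifold.maximalAtlas I 1 M :=
    IsManifold.maximalAtlas_subset_of_le (I := I) (M := M) (by norm_num) he
  rw [hessianInChart_apply_eq_fderiv_fderiv_of_isInteriorPoint he1 hxe hx, ← key,
    mhessian_apply_eq_fderiv_fderiv_of_isInteriorPoint' hx,
    ((writtenInExtChartAt_eventuallyEq_comp_extendCoordChange_of_isInteriorPoint (f := f) hxe hx).fderiv).fderiv_eq]

/-- **Nondegeneracy of the Hessian at a critical interior point is chart-independent.** [cite: Milnor1963, §2] -/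
theorem nondegenerate_mhessian_iff_of_isInteriorPoint [IsManifold I 2 M]
    (hf : ContMDiffAt I 𝓘(ℝ, ℝ) 2 f x) (hcrit : IsMCriticalPt I f x)
    (he : e ∈ IsManifold.maximalAtlas I 2 M) (hxe : x ∈ e.source) (hx : I.IsInteriorPoint x) :
    (mhessian I f x).Nondegenerate ↔ (hessianInChart I e f x).Nondegenerate := by
  obtain ⟨L, hL⟩ := isInvertible_fderiv_extendCoordChange_chartAt_of_isInteriorPoint he hxe hx
  refine nondegenerate_iff_of_forall_apply_eq (L : E ≃L[ℝ] E).toLinearEquiv fun v w => ?_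
  rw [mhessian_apply_eq_hessianInChart_of_isInteriorPoint hf hcrit he hxe hx, ← hL]
  rfl

/-- **The Morse index at a critical interior point is chart-independent**: it is the
negative index of inertia of the Hessian read in any chart of the `C²` maximal atlas. [cite: Milnor1963, §2] -/
theorem morseIndex_eq_sigNeg_hessianInChart_of_isInteriorPoint [IsManifold I 2 M]
    (hf : ContMDiffAt I 𝓘(ℝ, ℝ) 2 f x) (hcrit : IsMCriticalPt I f x)
    (he : e ∈ IsManifold.maximalAtlas I 2 M) (hxe : x ∈ e.source) (hx : I.IsInteriorPoint x) :
    morseIndex I f x = sigNeg (hessianInChart I e f x).toQuadraticMap := by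
  obtain ⟨L, hL⟩ := isInvertible_fderiv_extendCoordChange_chartAt_of_isInteriorPoint he hxe hx
  unfold morseIndex
  refine sigNeg_eq_of_forall_apply_eq (L : E ≃L[ℝ] E).toLinearEquiv fun v w => ?_
  rw [mhessian_apply_eq_hessianInChart_of_isInteriorPoint hf hcrit he hxe hx, ← hL]
  rfl

end ChangeOfChart

end Literature.Topology.FourManifolds
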